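import Summits.BirchSwinnertonDyer.Rank1Residual.Additive.KummerLeGreenbergTwistLevel
import Summits.BirchSwinnertonDyer.Rank1Residual.AdditivePotMult.PotMultRamifiedLineKummerEqAt
import Summits.BirchSwinnertonDyer.Rank1Residual.X2.ResidualDevissageNoTorsion
import Literature.NumberTheory.EllipticCurves.Rank1Residual.GVParityTransferProofs
import Literature.NumberTheory.EllipticCurves.AnomalousOfRationalTorsionProofs
import Literature.NumberTheory.EllipticCurves.MazurTorsionGaloisStructureProofs
import HarnessLib

/-!
# X3 on the semistable-twist locus, cell (G-ord, `e = 2`): the TWISTED Greenberg datum of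
# `W = C • V^{(p*)}` has `p`-torsion plus-part EQUAL to the even rational line `Φ₀` — road-map step
# (d′) of the algebraic count `hAlgW` (cell `bsd-addord`, seat `bsd-addord-twist`, strategy = twist
# transport; memo v2.1 §7; sequel of `X3TwistedDatumDevissage.lean`, consumed by
# `X3BranchAlgebraicCountW.lean`)

HONEST FRAMING (cell `bsd-addord`, `run/shared/lean/pub/bsd-addord/README.md` §4): the programme's
target of record is the full Birch–Swinnerton-Dyer formula for every `E/ℚ` of analytic rank `≤ 1`;
this file concerns the X3 rows (`E[p]` reducible) of cell (G-ord, `e = 2`) of N10 only and is a TOOL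
toward the displayed count `hAlgW` of the seat's end-state files
(`X3BranchAnalyticHalfGordDescent[EndState].lean`). THEOREMS ONLY (no `def`, no named fact, no
`sorry`); nothing is booked by this file; no named fact enters.

## What and why

Greenberg–Vatsal's display (16) (GV 2000 §2 p. 28) is run in the tree for Greenberg data whose
`p`-torsion plus-part IS the even rational line `Φ₀` (`X3TwistedDatum.natCard_gvSelmer_torsion_eq_mul_of_plus_eq_line`,
hypothesis `hplus`). At an ADDITIVE prime of type (G)-ordinary with defect `2` the Greenberg datum of
`W = C • V^{(p*)}` (`V` good ordinary) is the TWIST `C = t(C_v(V))` of Greenberg's kernel-of-reduction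
line along the geometric transport `t : V[p^∞] ≃ W[p^∞]` (`+`-equivariant on `Gal(ℚ̄/ℚ(√p*))`,
`−` off it; tree `twistMap (reductionDatum V p) t`, a RAMIFIED ORDINARY LINE by
`TameDescent.isRamifiedOrdinaryLine_twistMap_geomTransport`). THIS FILE supplies `hplus` there:

* §1 **`torsionDatum_plus_eq_lineSub_of_chiTwist`** — the `χ_K`-TWISTED Serre-line lemma (twin of
  X2's `torsionData_plus_eq_lineSub`): a local datum `N` at `v ∋ p` with
  `x • m − χ_K(x)•m ∈ N.plus` for every `x ∈ I_v` (`χ_K(x) = ±1` as `x ∈ Gal(ℚ̄/K)` or not) and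
  `#(N.plus ∩ W[p]) = p` has `N.plus ∩ W[p] = Φ₀` for EVERY rational line `Φ₀` whose `χ_K`-twist is
  ramified at `p` (GV p. 28 "`Φ = C[p]`" at the twisted datum); with the `χ_K`-twisted twins
  `exists_inertia_smul_ne_chi_of_not_forall` / `eq_of_not_forall_chi` of the tree's
  `exists_inertia_smul_ne_of_not_lineUnramifiedAt` / `eq_of_not_lineUnramifiedAt` (conjugacy of the
  primes above `p`; `Gal(ℚ̄/K) ⊴ Γ_ℚ`).
* §2 **`twistedDatum_smul_sub_chi_mem`** — on `t(C_v(V))` inertia acts modulo the line through `χ_K`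
  (it acts trivially modulo `C_v(V)`, `reductionDatum_htriv`, and `t` is `χ_K`-semilinear);
  **`torsionDatum_twistedDatum_plus_eq_lineSub`**, **`exists_data_isRamifiedOrdinaryLine_plus_eq_lineSub`**
  — so its `p`-torsion plus-part IS `Φ₀`, packaged as Greenberg data above `p` of ramified ordinary
  lines with `(torsionDatum (Lf v) p).plus = lineSub Φ₀`.
* §3 `not_dvd_torsionOrder_of_line` — `p ∤ #W(ℚ)_tors` for `Φ₀` ramified at `p` and even, `p` odd
  (a rational point of order `p` would be a non-zero `Γ_ℚ`-fixed point of `W[p^∞]`, excluded by X2's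
  `eq_zero_of_forall_smul_eq_primary`) — the torsion binder of the GV/Greenberg records downstream.

## What this is NOT

Not the (M) cell (Tate datum); not a Selmer-group statement (the sequel does the count); nothing about
a class; no label, tier or count of record moves.

References: [GreenbergVatsal2000] §2 p. 28 ("`Φ = C[p]`"), Prop. (2.8); [GreenbergLNM1716] §2
pp. 62–63, 69 (the datum `C_v`, inertia on it); [EmertonPollackWeston2006] §3.1 (the line datum
`A'_{f̃,a}`); [SilvermanAEC2009] X.5 Cor. 5.4 (twist transport).
-/

set_option autoImplicit false

noncomputable section

open scoped Classical AddSubgroup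

namespace Summit.BirchSwinnertonDyer.Rank1Residual.Additive

open NumberField IsDedekindDomain Field WeierstrassCurve
  Literature.NumberTheory.GaloisRepresentations
  Literature.NumberTheory.EllipticCurves
  Literature.NumberTheory.EllipticCurves.GreenbergSelmer
  Literature.NumberTheory.EllipticCurves.GreenbergVatsal2000
  Literature.NumberTheory.EllipticCurves.EmertonPollackWeston2006
  Literature.NumberTheory.EllipticCurves.Rank1Residual
  Summit.BirchSwinnertonDyer.Rank1Residual.X2
  Summit.BirchSwinnertonDyer.Rank1Residual.X2.GreenbergVatsalTorsion
  Summit.BirchSwinnertonDyer.Rank1Residual.X2.GreenbergVatsalReductionDatum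
  Summit.BirchSwinnertonDyer.Rank1Residual.X2.ResidualDevissageLine
  Summit.BirchSwinnertonDyer.Rank1Residual.X1.MuLambda
  Summit.BirchSwinnertonDyer.Rank1Residual.GaloisImage.RamifiedOrdinaryLineTwist
  Summit.BirchSwinnertonDyer.Rank1Residual.AdditivePotMult
  Summit.BirchSwinnertonDyer.Rank1Residual.AdditivePotMult.RamifiedOrdinaryLinePotMult
  Summit.BirchSwinnertonDyer.Rank1Residual.Additive.TameDescent

/-! ### §1 (d′) The `χ_K`-twisted Serre line: `N.plus ∩ W[p] = Φ₀` -/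

section ChiSerre

variable {W : WeierstrassCurve ℚ} {p : ℕ} [hp : Fact p.Prime]
  {Φ₀ : AddSubgroup (geomTorsion W (p : ℤ))} (hΦ : IsRationalLine W p Φ₀)
  (K : Type) [Field K] [NumberField K] [(galRange (K := ℚ) K).Normal]

include hΦ in
/-- **A rational line whose `χ_K`-twist is moved by the inertia group of ONE prime above `p` is moved
(after the twist) by the inertia group of EVERY prime above `p`**: the primes above `p` are conjugate
under `Γ_ℚ`, `I_{g𝔓} = g I_𝔓 g⁻¹`, the line is `Γ_ℚ`-stable and `χ_K(gσg⁻¹) = χ_K(σ)`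
(`Gal(ℚ̄/K) ⊴ Γ_ℚ`). The `χ_K`-twisted twin of the tree's
`exists_inertia_smul_ne_of_not_lineUnramifiedAt`. [folklore] -/
theorem exists_inertia_smul_ne_chi_of_not_forall
    (h : ¬ ∀ v : HeightOneSpectrum (𝓞 ℚ), ((p : ℕ) : 𝓞 ℚ) ∈ v.asIdeal →
      ∀ 𝔓 ∈ v.primesAbove, ∀ σ ∈ 𝔓.inertia (absoluteGaloisGroup ℚ), ∀ P ∈ Φ₀,
        σ • P = (if σ ∈ galRange (K := ℚ) K then P else -P))
    (v : HeightOneSpectrum (𝓞 ℚ)) (hv : ((p : ℕ) : 𝓞 ℚ) ∈ v.asIdeal)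
    (𝔓 : Ideal (absIntegers (𝓞 ℚ) ℚ)) (h𝔓 : 𝔓 ∈ v.primesAbove) :
    ∃ σ ∈ 𝔓.inertia (absoluteGaloisGroup ℚ), ∃ P ∈ Φ₀,
      σ • P ≠ (if σ ∈ galRange (K := ℚ) K then P else -P) := by
  have hpr : p.Prime := hp.out
  simp only [not_forall, exists_prop] at h
  obtain ⟨v₀, hv₀, 𝔓₀, h𝔓₀, σ₀, hσ₀, P₀, hP₀, hne⟩ := h
  have hvv : v₀ = v := heightOneSpectrum_eq_of_natCast_mem hpr hv₀ hv
  subst hvv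
  obtain ⟨g₁, hg₁⟩ := HeightOneSpectrum.exists_smul_eq_of_mem_primesAbove_holds h𝔓₀ h𝔓
  have hiff : g₁ * σ₀ * g₁⁻¹ ∈ galRange (K := ℚ) K ↔ σ₀ ∈ galRange (K := ℚ) K := by
    constructor
    · intro h1
      have h2 := Subgroup.Normal.conj_mem inferInstance _ h1 g₁⁻¹
      rwa [inv_inv, ← mul_assoc, ← mul_assoc, inv_mul_cancel, one_mul, mul_assoc, inv_mul_cancel,
        mul_one] at h2
    · exact fun h1 ↦ Subgroup.Normal.conj_mem inferInstance _ h1 g₁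
  refine ⟨g₁ * σ₀ * g₁⁻¹, ?_, g₁ • P₀, hΦ.2 g₁ P₀ hP₀, ?_⟩
  · rw [← hg₁]
    exact (Ideal.conj_mem_inertia_smul_iff 𝔓₀ g₁ σ₀).mpr hσ₀
  · intro heq
    apply hne
    rw [mul_smul, mul_smul, inv_smul_smul] at heq
    simp only [hiff] at heq
    by_cases hs : σ₀ ∈ galRange (K := ℚ) K
    · rw [if_pos hs] at heq ⊢
      exact MulAction.injective g₁ heq
    · rw [if_neg hs] at heq ⊢
      rw [← smul_neg] at heq
      exact MulAction.injective g₁ heq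

include hΦ in
/-- **The `χ_K`-twisted Serre line equals any rational line whose `χ_K`-twist is ramified.** Given a
line `L ≤ W[p]` of order `p` with `τ • P − χ_K(τ)P ∈ L` for every `τ` in the inertia group of `𝔓`
and every `P ∈ W[p]`, a rational line `Φ` with `τ • P₀ ≠ χ_K(τ)P₀` for some inertia `τ` and
`P₀ ∈ Φ` (at any prime above `p`, by the previous lemma) EQUALS `L`: `τ • P₀ − χ_K(τ)P₀ ∈ Φ ⊓ L` is
non-zero. Twin of the tree's `eq_of_not_lineUnramifiedAt`. [folklore] -/
theorem eq_of_not_forall_chi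
    (h : ¬ ∀ v : HeightOneSpectrum (𝓞 ℚ), ((p : ℕ) : 𝓞 ℚ) ∈ v.asIdeal →
      ∀ 𝔓 ∈ v.primesAbove, ∀ σ ∈ 𝔓.inertia (absoluteGaloisGroup ℚ), ∀ P ∈ Φ₀,
        σ • P = (if σ ∈ galRange (K := ℚ) K then P else -P))
    {v : HeightOneSpectrum (𝓞 ℚ)} (hv : ((p : ℕ) : 𝓞 ℚ) ∈ v.asIdeal)
    {𝔓 : Ideal (absIntegers (𝓞 ℚ) ℚ)} (h𝔓 : 𝔓 ∈ v.primesAbove)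
    {L : AddSubgroup (geomTorsion W (p : ℤ))} (hLcard : Nat.card L = p)
    (hLsub : ∀ σ ∈ 𝔓.inertia (absoluteGaloisGroup ℚ), ∀ P : geomTorsion W (p : ℤ),
      σ • P - (if σ ∈ galRange (K := ℚ) K then P else -P) ∈ L) :
    Φ₀ = L := by
  rcases line_eq_or_inf_eq_bot hΦ.1 hLcard with h1 | h1
  · exact h1
  · exfalso
    obtain ⟨τ, hτ, P₀, hP₀, hne⟩ := exists_inertia_smul_ne_chi_of_not_forall hΦ K h v hv 𝔓 h𝔓
    have hχ : (if τ ∈ galRange (K := ℚ) K then P₀ else -P₀) ∈ Φ₀ := by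
      split_ifs
      · exact hP₀
      · exact Φ₀.neg_mem hP₀
    have hmem : τ • P₀ - (if τ ∈ galRange (K := ℚ) K then P₀ else -P₀) ∈ Φ₀ ⊓ L :=
      AddSubgroup.mem_inf.mpr ⟨Φ₀.sub_mem (hΦ.2 τ P₀ hP₀) hχ, hLsub τ hτ P₀⟩
    rw [h1, AddSubgroup.mem_bot, sub_eq_zero] at hmem
    exact hne hmem

include hΦ in
/-- **(d′) `C ∩ W[p^∞][p] = Φ₀` at a `χ_K`-TWISTED datum.** For a Greenberg local datum `N` at
`v ∋ p` such that every `x ∈ I_v` satisfies `x • m − χ_K(x)•m ∈ N.plus` on `W[p^∞]` (`χ_K(x) = ±1`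
according as `x ∈ Gal(ℚ̄/K)` or not — the shape of the TWIST of an inertially-trivial datum by the
quadratic character of `K`) and `#(N.plus ∩ W[p^∞][p]) = p`, and every rational line `Φ₀` whose
`χ_K`-twist is RAMIFIED at `p` (`hram`): `(torsionDatum N p).plus = lineSub Φ₀`. GV p. 28 "`Φ = C[p]`"
read at the twisted datum; the proof is X2's `torsionData_plus_eq_lineSub` with §1's twisted Serre
line. [cite: GreenbergVatsal2000, §2 p. 28] -/
theorem torsionDatum_plus_eq_lineSub_of_chiTwist
    (hram : ¬ ∀ v : HeightOneSpectrum (𝓞 ℚ), ((p : ℕ) : 𝓞 ℚ) ∈ v.asIdeal →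
      ∀ 𝔓 ∈ v.primesAbove, ∀ σ ∈ 𝔓.inertia (absoluteGaloisGroup ℚ), ∀ P ∈ Φ₀,
        σ • P = (if σ ∈ galRange (K := ℚ) K then P else -P))
    {v : HeightOneSpectrum (𝓞 ℚ)} (hv : ((p : ℕ) : 𝓞 ℚ) ∈ v.asIdeal)
    (N : LocalDatum ℚ (W.geomPrimaryTorsion p) v)
    (htw : ∀ x ∈ inertia v, ∀ m : W.geomPrimaryTorsion p,
      x • m - (if x ∈ galRange (K := ℚ) K then m else -m) ∈ N.plus)
    (hcard : Nat.card ↥(N.plus ⊓ (↥(W.geomPrimaryTorsion p))[(p : ℤ)]) = p) :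
    (torsionDatum N p).plus = (lineSub Φ₀ hΦ).toAddSubgroup := by
  -- the twisted Serre line inside `W[p]`
  set X : AddSubgroup (geomTorsion W (p : ℤ)) :=
    N.plus.comap (AddSubgroup.inclusion (geomTorsion_le_geomPrimaryTorsion W p)) with hX
  have hXcard : Nat.card X = p := by
    rw [hX, TateLineDecomposition.natCard_comap_eq W p N, hcard]
  have hXsub : ∀ σ ∈ (adicCompletionPrime ℚ v).inertia (absoluteGaloisGroup ℚ),
      ∀ P : geomTorsion W (p : ℤ), σ • P - (if σ ∈ galRange (K := ℚ) K then P else -P) ∈ X := by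
    intro σ hσ P
    rw [inertia_adicCompletionPrime_eq_map_absInertia] at hσ
    have h1 := htw σ hσ (AddSubgroup.inclusion (geomTorsion_le_geomPrimaryTorsion W p) P)
    rw [hX, TateLineDecomposition.mem_comap_iff, map_sub, TateLineDecomposition.inclusion_smul]
    by_cases hs : σ ∈ galRange (K := ℚ) K
    · rw [if_pos hs] at h1 ⊢
      exact h1
    · rw [if_neg hs] at h1 ⊢
      rw [map_neg]
      exact h1
  have hΦX : Φ₀ = X :=
    eq_of_not_forall_chi hΦ K hram hv (adicCompletionPrime_mem_primesAbove ℚ v) hXcard hXsub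
  -- compare inside `W[p^∞][p]`
  ext m
  obtain ⟨P, rfl⟩ := (torsionToPrimary_bijective W p).2 m
  rw [torsionToPrimary_mem_lineSub_iff, hΦX, hX, TateLineDecomposition.mem_comap_iff]
  rfl

end ChiSerre

/-! ### §2 The twisted Greenberg datum of `W = C • V^{(p*)}`: `I_v` acts on `W[p^∞]/C` through `χ_K` -/

section TwistedDatum

variable (V : WeierstrassCurve ℚ) [V.IsElliptic] [V.IsGloballyMinimal]
  (K : Type) [Field K] [NumberField K]
  (h2 : Module.finrank ℚ K = 2) {θ : K} (hθ : θ ∉ Set.range (algebraMap ℚ K)) (p : ℕ) [hp : Fact p.Prime]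
  (hc : θ ^ 2 = algebraMap ℚ K ((-1) ^ (p / 2) * p))
  {W : WeierstrassCurve ℚ} {C : VariableChange ℚ}
  (hC : C • V.quadraticTwist ((-1 : ℚ) ^ (p / 2) * p) = W)

omit [V.IsElliptic] in
include h2 in
/-- **On the twisted datum `C = t(C_v(V))`, inertia acts on `W[p^∞]` modulo `C` through `χ_K`:**
`x • m − χ_K(x)•m ∈ C` for `x ∈ I_v`, `m ∈ W[p^∞]`. Indeed `x` acts trivially on `V[p^∞]/C_v(V)`
(Greenberg's good-ordinary datum, `reductionDatum_htriv`) and the transport `t` is `χ_K`-semilinear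
(`geomTransport_smul_of_mem` / `_of_not_mem`). [cite: GreenbergLNM1716, §2 pp. 62–63 and p. 69]
[cite: SilvermanAEC2009, X.5 Cor. 5.4] -/
theorem twistedDatum_smul_sub_chi_mem (hΔ : ¬ (p : ℤ) ∣ V.minimalDiscriminantInt)
    {v : HeightOneSpectrum (𝓞 ℚ)} (hpv : ((p : ℕ) : 𝓞 ℚ) ∈ v.asIdeal) :
    ∀ x ∈ inertia v, ∀ m : W.geomPrimaryTorsion p,
      x • m - (if x ∈ galRange (K := ℚ) K then m else -m) ∈
        (twistMap (reductionDatum V p hpv hΔ)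
          ((twistPrimaryEquiv V K hθ hc p).symm.trans (primaryIso p hC))
          (geomTransport_sign V K h2 hθ hc p hC)).plus := by
  intro x hx m
  set t := (twistPrimaryEquiv V K hθ hc p).symm.trans (primaryIso p hC) with ht
  rw [mem_twistMap_plus_iff]
  have h0 := reductionDatum_htriv V p hpv hΔ x hx (t.symm m)
  by_cases hg : x ∈ galRange (K := ℚ) K
  · rw [if_pos hg]
    have h1 : t.symm (x • m - m) = x • t.symm m - t.symm m := by
      apply t.injective
      rw [t.apply_symm_apply, map_sub, ht, geomTransport_smul_of_mem V K hθ hc p hC hg,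
        AddEquiv.apply_symm_apply]
    rw [h1]
    exact h0
  · rw [if_neg hg, sub_neg_eq_add]
    have h1 : t.symm (x • m + m) = -(x • t.symm m - t.symm m) := by
      apply t.injective
      rw [t.apply_symm_apply, map_neg, map_sub, ht, geomTransport_smul_of_not_mem V K h2 hθ hc p hC hg,
        AddEquiv.apply_symm_apply]
      abel
    rw [h1]
    exact (reductionDatum V p hpv hΔ).plus.neg_mem h0

include h2 in
/-- **(d′) for the twisted datum of a good-ordinary `V`:** `p` odd, `p ∤ Δ_V`, `p ∤ a_p(V)`, `v ∋ p`,
`Φ₀ ≤ W[p]` a rational line whose `χ_K`-twist is ramified at `p`: the `p`-torsion plus-part of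
`t(C_v(V))` IS `Φ₀` — `(torsionDatum (twistMap …) p).plus = lineSub Φ₀`. (§1 with the previous
theorem; `#(C ∩ W[p]) = p` because `t(C_v(V))` is a ramified ordinary line,
`isRamifiedOrdinaryLine_twistMap_geomTransport`.) [cite: GreenbergVatsal2000, §2 p. 28]
[cite: EmertonPollackWeston2006, §3.1 (eq:ordes) (arXiv:math/0404484 p. 17)] -/
theorem torsionDatum_twistedDatum_plus_eq_lineSub [W.IsElliptic] [(galRange (K := ℚ) K).Normal]
    (hp2 : p ≠ 2)
    (hΔ : ¬ (p : ℤ) ∣ V.minimalDiscriminantInt) (hord : ¬ (p : ℤ) ∣ V.frobeniusTrace p)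
    {v : HeightOneSpectrum (𝓞 ℚ)} (hpv : ((p : ℕ) : 𝓞 ℚ) ∈ v.asIdeal)
    {Φ₀ : AddSubgroup (geomTorsion W (p : ℤ))} (hΦ : IsRationalLine W p Φ₀)
    (hram : ¬ ∀ w : HeightOneSpectrum (𝓞 ℚ), ((p : ℕ) : 𝓞 ℚ) ∈ w.asIdeal →
      ∀ 𝔓 ∈ w.primesAbove, ∀ σ ∈ 𝔓.inertia (absoluteGaloisGroup ℚ), ∀ P ∈ Φ₀,
        σ • P = (if σ ∈ galRange (K := ℚ) K then P else -P)) :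
    (torsionDatum (twistMap (reductionDatum V p hpv hΔ)
        ((twistPrimaryEquiv V K hθ hc p).symm.trans (primaryIso p hC))
        (geomTransport_sign V K h2 hθ hc p hC)) p).plus = (lineSub Φ₀ hΦ).toAddSubgroup :=
  torsionDatum_plus_eq_lineSub_of_chiTwist hΦ K hram hpv _
    (twistedDatum_smul_sub_chi_mem V K h2 hθ p hc hC hΔ hpv)
    (RamifiedLineUnique.natCard_plus_inf_torsionBy_eq
      (TameDescent.isRamifiedOrdinaryLine_twistMap_geomTransport V K h2 hθ hc p hC hp2 hΔ hord hpv
        (valuation_pStar p v hpv)))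

include h2 hθ hc hC in
/-- **Greenberg data of RAMIFIED ORDINARY LINES whose `p`-torsion plus-part is the line `Φ₀`** exist
on `W = C • V^{(p*)}` (`V` good ordinary at the odd `p`) for every rational line `Φ₀` with ramified
`χ_K`-twist: at the (unique) place above `p` take the twisted datum `t(C_v(V))`.
[cite: EmertonPollackWeston2006, §3.1 (eq:ordes) (arXiv:math/0404484 p. 17)]
[cite: GreenbergVatsal2000, §2 p. 28] -/
theorem exists_data_isRamifiedOrdinaryLine_plus_eq_lineSub [W.IsElliptic] [(galRange (K := ℚ) K).Normal]
    (hp2 : p ≠ 2) (hV : GoodOrd V p)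
    {Φ₀ : AddSubgroup (geomTorsion W (p : ℤ))} (hΦ : IsRationalLine W p Φ₀)
    (hram : ¬ ∀ w : HeightOneSpectrum (𝓞 ℚ), ((p : ℕ) : 𝓞 ℚ) ∈ w.asIdeal →
      ∀ 𝔓 ∈ w.primesAbove, ∀ σ ∈ 𝔓.inertia (absoluteGaloisGroup ℚ), ∀ P ∈ Φ₀,
        σ • P = (if σ ∈ galRange (K := ℚ) K then P else -P)) :
    ∃ Lf : Data ℚ (W.geomPrimaryTorsion p) p,
      (∀ (v : HeightOneSpectrum (𝓞 ℚ)) (hv : ((p : ℕ) : 𝓞 ℚ) ∈ v.asIdeal),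
        IsRamifiedOrdinaryLine W p (Lf v hv)) ∧
      ∀ (v : HeightOneSpectrum (𝓞 ℚ)) (hv : ((p : ℕ) : 𝓞 ℚ) ∈ v.asIdeal),
        (torsionDatum (Lf v hv) p).plus = (lineSub Φ₀ hΦ).toAddSubgroup := by
  have hΔ : ¬ (p : ℤ) ∣ V.minimalDiscriminantInt :=
    V.not_dvd_minimalDiscriminantInt_of_hasGoodReductionAtPrime' p hV.1
  have h : ∀ (v : HeightOneSpectrum (𝓞 ℚ)) (hv : ((p : ℕ) : 𝓞 ℚ) ∈ v.asIdeal),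
      ∃ L : LocalDatum ℚ (W.geomPrimaryTorsion p) v, IsRamifiedOrdinaryLine W p L ∧
        (torsionDatum L p).plus = (lineSub Φ₀ hΦ).toAddSubgroup := fun v hv ↦
    ⟨_, TameDescent.isRamifiedOrdinaryLine_twistMap_geomTransport V K h2 hθ hc p hC hp2 hΔ hV.2 hv
        (valuation_pStar p v hv),
      torsionDatum_twistedDatum_plus_eq_lineSub V K h2 hθ p hc hC hp2 hΔ hV.2 hv hΦ hram⟩
  choose Lf hLf using h
  exact ⟨Lf, fun v hv ↦ (hLf v hv).1, fun v hv ↦ (hLf v hv).2⟩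

end TwistedDatum

/-! ### §3 No rational `p`-torsion on the rows (`Φ₀` ramified and even, `p` odd) -/

section NoTorsion

variable {W : WeierstrassCurve ℚ} [W.IsElliptic] {p : ℕ} [hp : Fact p.Prime]
  {Φ₀ : AddSubgroup (geomTorsion W (p : ℤ))} (hΦ : IsRationalLine W p Φ₀)

include hΦ in
/-- **`p ∤ #W(ℚ)_tors`** when `W[p]` has a rational line RAMIFIED at `p` and EVEN, `p` odd: a rational
point of order `p` (Cauchy in `W(ℚ)_tors`) would give a non-zero `Γ_ℚ`-fixed point of `W[p^∞]`,
excluded in GV's first case (X2 `eq_zero_of_forall_smul_eq_primary`).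
[cite: GreenbergVatsal2000, §2 Prop. (2.8), p. 28] -/
theorem not_dvd_torsionOrder_of_line (hp2 : p ≠ 2) (hram : ¬ LineUnramifiedAt W p Φ₀)
    (heven : LineEven W p Φ₀) : ¬ p ∣ W.torsionOrder := by
  intro h
  obtain ⟨T, hT⟩ := exists_addOrderOf_eq_of_dvd_torsionOrder W p h
  obtain ⟨Pb, -, hPb0, hfix⟩ := exists_geomTorsion_of_addOrderOf_eq W
    ((Rank1Residual.addOrderOf_point_eq_of_subsingleton W _ _ _).trans hT)
  have h0 := ResidualDevissageNoTorsion.eq_zero_of_forall_smul_eq_primary W p hΦ hp2 hram heven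
    (AddSubgroup.inclusion (geomTorsion_le_geomPrimaryTorsion W p) Pb)
    (fun σ ↦ by rw [← TateLineDecomposition.inclusion_smul, hfix])
  exact hPb0 (AddSubgroup.inclusion_injective _ (by rw [h0, map_zero]))

end NoTorsion

end Summit.BirchSwinnertonDyer.Rank1Residual.Additive

end
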